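import Summits.HodgeConjecture.HodgeCM.PerL34.GenuineSchrodingerModel_1

/-! PORT of `HodgeCM/PerL34/GenuineSchrodingerModel.lean` (HodgeCMPerL run 82) — part 2: continuation of `Summits.HodgeConjecture.HodgeCM.PerL34.GenuineSchrodingerModel_1` (split at a top-level declaration boundary by port_pkg.py; scope re-opened below; declarations unchanged). -/

-- port_pkg: scope re-opened for this part (file-level context, then the namespace/section stack open at the cut)
set_option linter.unusedSectionVars false
set_option linter.unusedVariables false
set_option linter.style.longLine false
set_option linter.style.header false
set_option linter.style.cdot false
set_option linter.style.setOption false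
set_option linter.style.multiGoal false
set_option linter.flexible false
set_option autoImplicit false
noncomputable section
open MeasureTheory MeasureTheory.Measure Set Metric Function Complex ComplexConjugate Topology Filter
open scoped RestrictedProduct InnerProductSpace NNReal ENNReal Pointwise
namespace HodgeCM.PerL34.PureTensor
open HodgeCM.PerL34.LocalFactors HodgeCM.PerL34.LocalFactors.DilationModel
open HodgeCM.PerL34.IdelePlaces HodgeCM.PerL34.RestrictedRegroup HodgeCM.PerL34.RestrictedCutout
open HodgeCM.PerL34.IdelicTorusModel HodgeCM.PerL34.IdelicTorusModel.Genuine NumberField IsDedekindDomain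
attribute [local instance] LocalFactors.DilationModel.Adic.nontriviallyNormedField
  LocalFactors.DilationModel.Adic.properSpace
namespace SchrodingerModel
variable (L : Type) [Field L] [NumberField L] [IsCMField L]
local notation3 "L⁺" => maximalRealSubfield L
variable {L}
section Slice
variable [∀ v : HeightOneSpectrum (𝓞 (maximalRealSubfield L)), MeasurableSpace (v.adicCompletion (maximalRealSubfield L))]
  [∀ v : HeightOneSpectrum (𝓞 (maximalRealSubfield L)), BorelSpace (v.adicCompletion (maximalRealSubfield L))]
variable [DecidableEq (Place (maximalRealSubfield L))]
/-- a model element supported at one split index dilates the box inside the cylinder -/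
theorem smul_set_box (k : Model L) (i : SplitIdx L) (hk : ∀ j : SplitIdx L, j ≠ i → unitAt k j = 1) :
    k • (box L : Set (Space L)) = cyl L i ∩ (fun x => x i) ⁻¹' (unitAt k i • (cube L i : Set (Coord L i))) := by
  ext y
  rw [Set.mem_smul_set_iff_inv_smul_mem, mem_box_iff, mem_inter_iff, mem_cyl_iff, mem_preimage,
    Set.mem_smul_set_iff_inv_smul_mem]
  constructor
  · intro h
    refine ⟨fun j hj => ?_, ?_⟩
    · have := h j
      rwa [smul_apply, unitAt_inv, hk j hj, inv_one, Units.val_one, one_smul] at this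
    · have := h i
      rwa [smul_apply, unitAt_inv] at this
  · rintro ⟨h1, h2⟩ j
    by_cases hj : j = i
    · subst hj
      rw [smul_apply, unitAt_inv]
      exact h2
    · rw [smul_apply, unitAt_inv, hk j hj, inv_one, Units.val_one, one_smul]
      exact h1 j hj

/-- **modulus compatibility**: the module of `X` at an element supported at the split index `v` is the local
module `δ_v` of `(L⁺_v)³` (`= |u|_v³`). -/
theorem distribHaarChar_eq (k : Model L) (i : SplitIdx L) (hk : ∀ j : SplitIdx L, j ≠ i → unitAt k j = 1) :
    distribHaarChar (Space L) k = distribHaarChar (Coord L i) (unitAt k i) := by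
  refine distribHaarChar_eq_of_measure_smul_eq_mul (μ := μ L) (s := (box L : Set (Space L)))
    (by rw [μ_box]; exact one_ne_zero) (by rw [μ_box]; exact ENNReal.one_ne_top) ?_
  rw [smul_set_box k i hk, ← sliceMeasure_apply i ((cube L i).isOpen.measurableSet.const_smul (unitAt k i)),
    sliceMeasure_eq_muV, ← distribHaarChar_mul, μ_box, mul_one]
  rw [show (cube L i : Set (Coord L i)) = (Adic.integerCube L⁺ (basePlaceOf L i.1) : Set (Coord L i)) from rfl,
    Adic.muV, addHaarMeasure_self, mul_one]

end Slice

/-! ## §4  Extension by zero `L²(s, μ|_s) ↪ L²(μ)` and the coordinate intertwiners `V_v : L²(dx_v) ↪ L²(X)` -/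

section ExtendByZero

variable {α : Type*} [MeasurableSpace α] {m : Measure α} {s : Set α}

/-- (Ported verbatim from the HodgeCMPerL package; no docstring in the source.) -/
theorem memLp_indicator_of_restrict (hs : MeasurableSet s) (f : Lp ℂ 2 (m.restrict s)) :
    MemLp (s.indicator ⇑f) 2 m :=
  (memLp_indicator_iff_restrict hs).2 (Lp.memLp f)

/-- extension by zero: `f ∈ L²(μ|_s) ↦ 1_s · f ∈ L²(μ)`, a linear isometry -/
def extendByZero (hs : MeasurableSet s) : Lp ℂ 2 (m.restrict s) →ₗᵢ[ℂ] Lp ℂ 2 m where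
  toFun f := (memLp_indicator_of_restrict hs f).toLp _
  map_add' f g := by
    rw [← MemLp.toLp_add]
    refine MemLp.toLp_congr _ _ ?_
    have h := (ae_eq_restrict_iff_indicator_ae_eq hs).1 (Lp.coeFn_add f g)
    refine h.trans (Filter.Eventually.of_forall fun x => ?_)
    rw [Set.indicator_add']
  map_smul' c f := by
    rw [RingHom.id_apply, ← MemLp.toLp_const_smul]
    refine MemLp.toLp_congr _ _ ?_
    have h := (ae_eq_restrict_iff_indicator_ae_eq hs).1 (Lp.coeFn_smul c f)
    refine h.trans (Filter.Eventually.of_forall fun x => ?_)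
    by_cases hx : x ∈ s
    · simp only [Set.indicator_of_mem hx, Pi.smul_apply]
    · simp only [Set.indicator_of_notMem hx, Pi.smul_apply, smul_zero]
  norm_map' f := by
    simp only [LinearMap.coe_mk, AddHom.coe_mk]
    rw [Lp.norm_toLp, eLpNorm_indicator_eq_eLpNorm_restrict hs, Lp.norm_def]

/-- (Ported verbatim from the HodgeCMPerL package; no docstring in the source.) -/
theorem coeFn_extendByZero (hs : MeasurableSet s) (f : Lp ℂ 2 (m.restrict s)) :
    ⇑(extendByZero hs f) =ᵐ[m] s.indicator ⇑f :=
  MemLp.coeFn_toLp (memLp_indicator_of_restrict hs f)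

end ExtendByZero

section Intertwiner

variable [∀ v : HeightOneSpectrum (𝓞 (maximalRealSubfield L)), MeasurableSpace (v.adicCompletion (maximalRealSubfield L))]
  [∀ v : HeightOneSpectrum (𝓞 (maximalRealSubfield L)), BorelSpace (v.adicCompletion (maximalRealSubfield L))]
  [DecidableEq (Place (maximalRealSubfield L))]

/-- **the coordinate intertwiner** `V_v : L²((L⁺_v)³, dx_v) ↪ L²(X, dx)`, `(V_v f)(x) = 1_{cyl v}(x) f(x_v)`
(`= f ⊗ ⊗_{w ≠ v} 1_{𝒪_w³}`), a linear isometry -/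
def V (i : SplitIdx L) : Lp ℂ 2 (Adic.muV L⁺ (basePlaceOf L i.1)) →ₗᵢ[ℂ] Lp ℂ 2 (μ L) :=
  (extendByZero (measurableSet_cyl i)).comp
    (Lp.compMeasurePreservingₗᵢ ℂ (fun x : Space L => x i) (measurePreserving_eval i))

/-- (Ported verbatim from the HodgeCMPerL package; no docstring in the source.) -/
theorem coeFn_V (i : SplitIdx L) (f : Lp ℂ 2 (Adic.muV L⁺ (basePlaceOf L i.1))) :
    ⇑(V i f) =ᵐ[μ L] (cyl L i).indicator (fun x => f (x i)) := by
  refine (coeFn_extendByZero (measurableSet_cyl i) _).trans ?_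
  exact (ae_eq_restrict_iff_indicator_ae_eq (measurableSet_cyl i)).1
    (Lp.coeFn_compMeasurePreserving f (measurePreserving_eval i))

/-- (Ported verbatim from the HodgeCMPerL package; no docstring in the source.) -/
theorem smul_mem_cyl_iff (k : Model L) (i : SplitIdx L) (hk : ∀ j : SplitIdx L, j ≠ i → unitAt k j = 1)
    (x : Space L) : k • x ∈ cyl L i ↔ x ∈ cyl L i := by
  simp only [mem_cyl_iff]
  refine forall₂_congr fun j hj => ?_
  rw [smul_apply, hk j hj, Units.val_one, one_smul]

/-- (Ported verbatim from the HodgeCMPerL package; no docstring in the source.) -/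
theorem weight_eq (k : Model L) (i : SplitIdx L) (hk : ∀ j : SplitIdx L, j ≠ i → unitAt k j = 1) :
    weight (Space L) (1 : Model L →* Circle) k
      = weight (Coord L i) (1 : ((basePlaceOf L i.1).adicCompletion L⁺)ˣ →* Circle) (unitAt k i) := by
  simp only [weight, MonoidHom.one_apply, distribHaarChar_eq k i hk]

/-- **equivariance of `V_v`** under an element of the model group supported at `v`:
`ω(ι_v g) (V_v f) = V_v (ω_v(baseTriv g) f)` with `ω_v` the local dilation representation on `L²((L⁺_v)³)`. -/
theorem rep_apply_V (k : Model L) (i : SplitIdx L) (hk : ∀ j : SplitIdx L, j ≠ i → unitAt k j = 1)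
    (f : Lp ℂ 2 (Adic.muV L⁺ (basePlaceOf L i.1))) :
    rep L 1 k (V i f) = V i (dilationRep (Adic.muV L⁺ (basePlaceOf L i.1))
      (1 : ((basePlaceOf L i.1).adicCompletion L⁺)ˣ →* Circle) (unitAt k i) f) := by
  apply Lp.ext
  have h1 := coeFn_dilationRep (μ L) (1 : Model L →* Circle) k (V i f)
  have h2 := (quasiMeasurePreserving_smul' (μ L) k).ae_eq_comp (coeFn_V i f)
  have h3 := coeFn_V i (dilationRep (Adic.muV L⁺ (basePlaceOf L i.1))
    (1 : ((basePlaceOf L i.1).adicCompletion L⁺)ˣ →* Circle) (unitAt k i) f)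
  have h4 := (ae_eq_restrict_iff_indicator_ae_eq (measurableSet_cyl i)).1
    ((measurePreserving_eval i).quasiMeasurePreserving.ae_eq_comp
      (coeFn_dilationRep (Adic.muV L⁺ (basePlaceOf L i.1))
        (1 : ((basePlaceOf L i.1).adicCompletion L⁺)ˣ →* Circle) (unitAt k i) f))
  filter_upwards [h1, h2, h3, h4] with x e1 e2 e3 e4
  simp only [Function.comp_def] at e2 e4
  rw [e1, e2, e3, e4]
  by_cases hx : x ∈ cyl L i
  · rw [indicator_of_mem ((smul_mem_cyl_iff k i hk x).2 hx), indicator_of_mem hx, smul_apply, weight_eq k i hk]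
    rfl
  · rw [indicator_of_notMem (mt (smul_mem_cyl_iff k i hk x).1 hx), indicator_of_notMem hx, mul_zero]

/-- the same for the embedded local element `ι_v(g)`, `g ∈ U(1)_v`, read through `baseTriv` -/
theorem rep_mulSingle_V (i : SplitIdx L) (g : locTorus L⁺ L i.1) (f : Lp ℂ 2 (Adic.muV L⁺ (basePlaceOf L i.1))) :
    rep L 1 (RestrictedProduct.mulSingle (genLevel L) i.1 g) (V i f)
      = V i (dilationRep (Adic.muV L⁺ (basePlaceOf L i.1))
          (1 : ((basePlaceOf L i.1).adicCompletion L⁺)ˣ →* Circle) (baseTriv L i.1 i.2 g) f) := by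
  rw [← unitAt_mulSingle_self i g]
  exact rep_apply_V _ i (fun j hj => unitAt_mulSingle_of_ne j (fun h => hj (Subtype.ext h)) g) f

/-! ## §5  The distinguished vector `φ⁰ = 1_{∏ 𝒪_v³} = ⊗_v 1_{𝒪_v³}` and the S3 input it generates -/

variable (L) in
/-- `φ⁰ = 1_{box} ∈ L²(X)` -/
def phi0 : Lp ℂ 2 (μ L) :=
  indicatorConstLp 2 (isOpen_box L).measurableSet (by rw [μ_box]; exact ENNReal.one_ne_top) (1 : ℂ)

/-- (Ported verbatim from the HodgeCMPerL package; no docstring in the source.) -/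
theorem norm_phi0 : ‖phi0 L‖ = 1 := by
  rw [phi0, norm_indicatorConstLp (by norm_num) (by norm_num), norm_one, one_mul, measureReal_def, μ_box,
    ENNReal.toReal_one, Real.one_rpow]

/-- `V_v 1_{𝒪_v³} = φ⁰` -/
theorem V_ballIndicator (i : SplitIdx L) : V i (ballIndicator (Adic.muV L⁺ (basePlaceOf L i.1)) 0 1) = phi0 L := by
  apply Lp.ext
  have h1 := coeFn_V i (ballIndicator (Adic.muV L⁺ (basePlaceOf L i.1)) 0 1)
  have h2 := (ae_eq_restrict_iff_indicator_ae_eq (measurableSet_cyl i)).1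
    ((measurePreserving_eval i).quasiMeasurePreserving.ae_eq_comp
      (indicatorConstLp_coeFn (p := 2) (μ := Adic.muV L⁺ (basePlaceOf L i.1))
        (hs := measurableSet_closedBall (x := (0 : Coord L i)) (ε := 1))
        (hμs := (isCompact_closedBall (0 : Coord L i) 1).measure_lt_top.ne) (c := (1 : ℂ))))
  have h3 := indicatorConstLp_coeFn (p := 2) (μ := μ L) (hs := (isOpen_box L).measurableSet)
    (hμs := by rw [μ_box]; exact ENNReal.one_ne_top) (c := (1 : ℂ))
  filter_upwards [h1, h2, h3] with x e1 e2 e3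
  rw [e1, show (cyl L i).indicator (fun x : Space L => (ballIndicator (Adic.muV L⁺ (basePlaceOf L i.1)) 0 1 :
    Coord L i → ℂ) (x i)) x = _ from e2, phi0, e3]
  simp only [Function.comp_def]
  by_cases hx : x ∈ (box L : Set (Space L))
  · have hx' := hx
    rw [box_eq_cyl_inter i] at hx'
    rw [indicator_of_mem hx, indicator_of_mem hx'.1, indicator_of_mem]
    rw [← coe_cube]; exact hx'.2
  · rw [indicator_of_notMem hx]
    by_cases hc : x ∈ cyl L i
    · rw [indicator_of_mem hc, indicator_of_notMem]
      intro hb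
      exact hx ((box_eq_cyl_inter i).symm ▸ ⟨hc, hb⟩)
    · rw [indicator_of_notMem hc]

/-! ### elements acting trivially on `X` (all split coordinates equal to one): non-split local elements -/

/-- (Ported verbatim from the HodgeCMPerL package; no docstring in the source.) -/
theorem smul_eq_self_of_unitAt (k : Model L) (hk : ∀ j : SplitIdx L, unitAt k j = 1) (x : Space L) : k • x = x := by
  ext j
  rw [smul_apply, hk j, Units.val_one, one_smul]

/-- (Ported verbatim from the HodgeCMPerL package; no docstring in the source.) -/
theorem smul_set_eq_self_of_unitAt (k : Model L) (hk : ∀ j : SplitIdx L, unitAt k j = 1) (A : Set (Space L)) :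
    k • A = A := by
  ext y
  rw [Set.mem_smul_set_iff_inv_smul_mem, smul_eq_self_of_unitAt k⁻¹ (fun j => by rw [unitAt_inv, hk j, inv_one]) y]

/-- (Ported verbatim from the HodgeCMPerL package; no docstring in the source.) -/
theorem distribHaarChar_eq_one_of_unitAt (k : Model L) (hk : ∀ j : SplitIdx L, unitAt k j = 1) :
    distribHaarChar (Space L) k = 1 := by
  refine distribHaarChar_eq_of_measure_smul_eq_mul (μ := μ L) (s := (box L : Set (Space L)))
    (by rw [μ_box]; exact one_ne_zero) (by rw [μ_box]; exact ENNReal.one_ne_top) ?_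
  rw [smul_set_eq_self_of_unitAt k hk, ENNReal.coe_one, one_mul]

/-- an element of the model group all of whose split coordinates are units equal to one acts TRIVIALLY on `L²(X)` -/
theorem rep_eq_self_of_unitAt (k : Model L) (hk : ∀ j : SplitIdx L, unitAt k j = 1) (f : Lp ℂ 2 (μ L)) :
    rep L 1 k f = f := by
  apply Lp.ext
  filter_upwards [coeFn_dilationRep (μ L) (1 : Model L →* Circle) k f] with x e1
  rw [e1, smul_eq_self_of_unitAt k hk, weight, MonoidHom.one_apply, distribHaarChar_eq_one_of_unitAt k hk]
  simp

/-- (Ported verbatim from the HodgeCMPerL package; no docstring in the source.) -/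
theorem unitAt_mulSingle_of_not_isSplitPlace {i : Place L⁺} (hns : ¬IsSplitPlace L i) (g : locTorus L⁺ L i)
    (j : SplitIdx L) : unitAt (RestrictedProduct.mulSingle (genLevel L) i g) j = 1 :=
  unitAt_mulSingle_of_ne (i := i) j (fun h : j.1 = i => hns (h ▸ j.2)) g

/-- in the split Schrödinger model the NON-SPLIT local groups `U(1)_v` act trivially -/
theorem rep_mulSingle_of_not_isSplitPlace {i : Place L⁺} (hns : ¬IsSplitPlace L i) (g : locTorus L⁺ L i)
    (f : Lp ℂ 2 (μ L)) : rep L 1 (RestrictedProduct.mulSingle (genLevel L) i g) f = f :=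
  rep_eq_self_of_unitAt _ (unitAt_mulSingle_of_not_isSplitPlace hns g) f

variable (L) in
/-- **The genuine global split Schrödinger model is an S3 input** (`GenuineThetaInput`) relative to ANY finite
set `S` of NON-SPLIT places (e.g. `S = ` all infinite places, as the headline's bookkeeping binder `hS` wants), for every
character `χ` of the model group trivial on the embedded local groups `ι_v(U(1)_v)`, `v ∈ S`:
`Sp = L²(Πʳ_{v split} (L⁺_v)³)`, `ω` the dilation representation of the model group through the split base charts (the
non-split local groups acting trivially), `φ = ⊗_v 1_{𝒪_v³}`, `ν_v = 1`, `V_v` the coordinate intertwiners; the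
split-`v ∈ S` fields are vacuous and `hiso` on `S` is `φ = conj χ(ι_v g) • φ`, i.e. the hypothesis `hχ`. -/
def thetaInputOfNonsplit (S : Finset (Place L⁺)) (hSns : ∀ i ∈ S, ¬IsSplitPlace L i) (χ : Model L →* Circle)
    (hχ : ∀ i ∈ S, ∀ g : locTorus L⁺ L i, χ (RestrictedProduct.mulSingle (genLevel L) i g) = 1) :
    GenuineThetaInput L S (Lp ℂ 2 (μ L)) (rep L 1) (phi0 L) χ where
  ν := fun _ => 1
  hν := fun _ _ _ _ _ => rfl
  VU := fun i _ hs => V ⟨i, hs⟩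
  hVUψ := fun i _ hs => V_ballIndicator ⟨i, hs⟩
  hVU := fun i _ hs g => rep_mulSingle_V ⟨i, hs⟩ g _
  x₀ := fun _ => 0
  r := fun _ => 1
  a := fun _ => 0
  hr := fun i hi hs => absurd hs (hSns i hi)
  hr0 := fun i hi hs => absurd hs (hSns i hi)
  hνS := fun i hi hs => absurd hs (hSns i hi)
  hχS := fun i hi hs => absurd hs (hSns i hi)
  VS := fun i hi hs => absurd hs (hSns i hi)
  hVSψ := fun i hi hs => absurd hs (hSns i hi)
  hVS := fun i hi hs => absurd hs (hSns i hi)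
  hiso := fun i hi hns g => by
    rw [rep_mulSingle_of_not_isSplitPlace hns g, hχ i hi g]
    simp

variable (L) in
/-- the case `S = ∅`: an S3 input for EVERY character `χ` -/
def thetaInput (χ : Model L →* Circle) : GenuineThetaInput L ∅ (Lp ℂ 2 (μ L)) (rep L 1) (phi0 L) χ :=
  thetaInputOfNonsplit L ∅ (fun i hi => absurd hi (Finset.notMem_empty i)) χ
    (fun i hi => absurd hi (Finset.notMem_empty i))

/-- **NON-VACUITY of the S3 input**: `GenuineThetaInput L S …` is inhabited for every CM field `L`, every finite set
`S` of non-split places and every character `χ` of the model group trivial on `ι_v(U(1)_v)`, `v ∈ S`. -/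
theorem nonempty_thetaInput_of_nonsplit (S : Finset (Place L⁺)) (hSns : ∀ i ∈ S, ¬IsSplitPlace L i)
    (χ : Model L →* Circle) (hχ : ∀ i ∈ S, ∀ g : locTorus L⁺ L i, χ (RestrictedProduct.mulSingle (genLevel L) i g) = 1) :
    Nonempty (GenuineThetaInput L S (Lp ℂ 2 (μ L)) (rep L 1) (phi0 L) χ) :=
  ⟨thetaInputOfNonsplit L S hSns χ hχ⟩

/-- in particular (`S = ∅`) for every character `χ`. -/
theorem nonempty_thetaInput (χ : Model L →* Circle) :
    Nonempty (GenuineThetaInput L ∅ (Lp ℂ 2 (μ L)) (rep L 1) (phi0 L) χ) :=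
  ⟨thetaInput L χ⟩

/-- the distinguished vector is a unit vector (headline binder `hφ`) -/
theorem norm_phi0_eq_one : ‖phi0 L‖ = 1 := norm_phi0

end Intertwiner

end SchrodingerModel

end HodgeCM.PerL34.PureTensor

end
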